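import Summits.ValiantsHypothesis.ValiantsHypothesis.Theorems.NcSupport
import HarnessLib

/-!
# The balanced block of a noncommutative syntactically multilinear circuit (HWY Lemma F.2, kernel)

Decomposition workshop `decomp-valiant`, lens 6, gen 4, move K5c of the node `CommutativityDial`
(support file 2/3 for the kernel proof of HWY10 Thm 1.12 in `Theorems.ApLowerBound`).

`exists_block` — a PARSE-TREE-FREE and HOMOGENISATION-FREE rendering of Hrubeš–Wigderson–Yehudayoff's
Lemma F.2 (structure of multilinear circuits via ml-central polynomials): in a fan-in-two,
syntactically multilinear gate list evaluated NONCOMMUTATIVELY, every support word `w` of a gate value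
with `|w| ≥ 2k/3` (`k ≥ 4`) factors as `w = α·γ·β`, where `γ` is a support word of an EARLIER gate `v`
with `k/3 ≤ |γ| < 2k/3` and the letters of `α, β` lie OUTSIDE the syntactic variable set `X_v`. The
walk descends from the gate along the heavier factor of each product gate until the length drops below
`2k/3`; syntactic multilinearity is used exactly once per product gate: the lighter factor's letters
live in the sibling operand's variable set (support discipline, `NcSupport.vars_ncGateValues`), which
is disjoint from the heavy operand's set `⊇ X_v`.

HONEST FRAMING: a lemma about a restricted model (nc ∧ syntactically multilinear); nothing here bears
on `VP ≠ VNP`.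

## References
* [HrubesWigdersonYehudayoff2010] P. Hrubeš, A. Wigderson, A. Yehudayoff, Relationless completeness and
  separations, CCC 2010 / ECCC TR10-021, §F.2 Lemma F.2 (and Prop. A.2).
* [RazYehudayoff2008] R. Raz, A. Yehudayoff, CCC 2008, §2 (syntactic multilinearity).
-/

namespace Summit.ValiantsHypothesis.ValiantsHypothesis.Theorems.ApBlock

open Literature.Computability.AlgebraicComplexity
open Literature.Computability.AlgebraicComplexity.ArithCircuit hiding ncGateValues ncEval ncGateValues_append_singleton
open Summit.ValiantsHypothesis.ValiantsHypothesis.Theorems.CommutativityDial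
open scoped Pointwise

universe u v

open Summit.ValiantsHypothesis.ValiantsHypothesis.Theorems.NcSupport

section Block

variable {R : Type u} [CommSemiring R] {σ : Type v} [DecidableEq σ]

/-! ## §4 The balanced block (HWY Lemma F.2 without homogenisation) -/

/-- The HEAVY SIDE step: a word `wh` of an operand value with `3·|wh| ≥ k` either is itself a balanced
block (if `3·|wh| < 2k`; then the operand is a gate reference, as `k ≥ 4` rules out letters and
scalars) or, by the induction hypothesis `ih` on the referenced gate, contains one.
[cite: HrubesWigdersonYehudayoff2010, Lemma F.2] -/
theorem heavy (k : ℕ) (hk : 4 ≤ k) (gs : List (Gate R σ))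
    (ih : ∀ j, j < gs.length → ∀ w ∈ supp ((ncGateValues gs).getD j 0), 2 * k ≤ 3 * w.length →
      ∃ j', j' ≤ j ∧ ∃ α γ β : FreeMonoid σ, w = α * γ * β ∧
        γ ∈ supp ((ncGateValues gs).getD j' 0) ∧ k ≤ 3 * γ.length ∧ 3 * γ.length < 2 * k ∧
        Disjoint (letters α ∪ letters β) ((gateVarSets gs).getD j' ∅) ∧
        (gateVarSets gs).getD j' ∅ ⊆ (gateVarSets gs).getD j ∅)
    (u : Operand R σ) {wh : FreeMonoid σ} (hwh : wh ∈ supp (ncOperandEval (ncGateValues gs) u))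
    (hk3 : k ≤ 3 * wh.length) :
    ∃ j, j < gs.length ∧ ∃ α γ β : FreeMonoid σ, wh = α * γ * β ∧
      γ ∈ supp ((ncGateValues gs).getD j 0) ∧ k ≤ 3 * γ.length ∧ 3 * γ.length < 2 * k ∧
      Disjoint (letters α ∪ letters β) ((gateVarSets gs).getD j ∅) ∧
      (gateVarSets gs).getD j ∅ ⊆ operandVarSet (gateVarSets gs) u := by
  rcases mem_supp_ncOperandEval hwh with ⟨x, rfl, rfl⟩ | ⟨c, rfl, rfl⟩ | ⟨j, rfl, hj, hw⟩
  · simp [FreeMonoid.length_of] at hk3; omega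
  · simp at hk3; omega
  · rw [length_ncGateValues] at hj
    by_cases h3 : 3 * wh.length < 2 * k
    · exact ⟨j, hj, 1, wh, 1, by simp, hw, hk3, h3, by simp [letters], subset_of_eq rfl⟩
    · obtain ⟨j', hj', α, γ, β, h, hγ, h1, h2, hd, hs⟩ := ih j hj wh hw (not_lt.1 h3)
      exact ⟨j', lt_of_le_of_lt hj' hj, α, γ, β, h, hγ, h1, h2, hd, hs⟩

/-- **The balanced block** (HWY Lemma F.2, parse-tree-free): in a fan-in-two syntactically multilinear
gate list, every support word `w` of the `i`-th gate value with `|w| ≥ 2k/3` (`k ≥ 4`) factors as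
`w = α·γ·β` with `γ` a support word of some gate `j ≤ i`, `k/3 ≤ |γ| < 2k/3`, the letters of `α, β`
outside the syntactic variable set `X_j`, and `X_j ⊆ X_i`. [cite: HrubesWigdersonYehudayoff2010, Lemma F.2] -/
theorem exists_block (k : ℕ) (hk : 4 ≤ k) (gs : List (Gate R σ)) (h2 : ∀ g ∈ gs, g.fanIn ≤ 2)
    (hsm : ∀ (i : ℕ) (args : List (Operand R σ)), gs[i]? = some (.prod args) →
      (args.map (operandVarSet (gateVarSets (gs.take i)))).Pairwise Disjoint) :
    ∀ i, ∀ w ∈ supp ((ncGateValues gs).getD i 0), 2 * k ≤ 3 * w.length →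
      ∃ j, j ≤ i ∧ ∃ α γ β : FreeMonoid σ, w = α * γ * β ∧
        γ ∈ supp ((ncGateValues gs).getD j 0) ∧ k ≤ 3 * γ.length ∧ 3 * γ.length < 2 * k ∧
        Disjoint (letters α ∪ letters β) ((gateVarSets gs).getD j ∅) ∧
        (gateVarSets gs).getD j ∅ ⊆ (gateVarSets gs).getD i ∅ := by
  induction gs using List.reverseRecOn with
  | nil => intro i w hw; simp [ncGateValues, supp_zero] at hw
  | append_singleton gs g ih =>
    have h2' : ∀ g ∈ gs, g.fanIn ≤ 2 := fun g hg => h2 g (List.mem_append_left _ hg)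
    have hsm' : ∀ (i : ℕ) (args : List (Operand R σ)), gs[i]? = some (.prod args) →
        (args.map (operandVarSet (gateVarSets (gs.take i)))).Pairwise Disjoint := by
      intro i args hi
      have hil : i < gs.length := (List.getElem?_eq_some_iff.1 hi).1
      have := hsm i args (by rwa [List.getElem?_append_left hil])
      rwa [List.take_append_of_le_length hil.le] at this
    replace ih := ih h2' hsm'
    have ihlt : ∀ j, j < gs.length → ∀ w ∈ supp ((ncGateValues gs).getD j 0),
        2 * k ≤ 3 * w.length → ∃ j', j' ≤ j ∧ ∃ α γ β : FreeMonoid σ, w = α * γ * β ∧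
          γ ∈ supp ((ncGateValues gs).getD j' 0) ∧ k ≤ 3 * γ.length ∧ 3 * γ.length < 2 * k ∧
          Disjoint (letters α ∪ letters β) ((gateVarSets gs).getD j' ∅) ∧
          (gateVarSets gs).getD j' ∅ ⊆ (gateVarSets gs).getD j ∅ := fun j _ => ih j
    -- transport of a conclusion about `gs` to `gs ++ [g]`
    have lift : ∀ {j : ℕ} (hj : j < gs.length) {W : Finset σ} (w : FreeMonoid σ),
        W = (gateVarSets (gs ++ [g])).getD j ∅ ∨ True →
        (∃ α γ β : FreeMonoid σ, w = α * γ * β ∧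
          γ ∈ supp ((ncGateValues gs).getD j 0) ∧ k ≤ 3 * γ.length ∧ 3 * γ.length < 2 * k ∧
          Disjoint (letters α ∪ letters β) ((gateVarSets gs).getD j ∅) ∧
          (gateVarSets gs).getD j ∅ ⊆ W) →
        ∃ α γ β : FreeMonoid σ, w = α * γ * β ∧
          γ ∈ supp ((ncGateValues (gs ++ [g])).getD j 0) ∧ k ≤ 3 * γ.length ∧
          3 * γ.length < 2 * k ∧
          Disjoint (letters α ∪ letters β) ((gateVarSets (gs ++ [g])).getD j ∅) ∧
          (gateVarSets (gs ++ [g])).getD j ∅ ⊆ W := by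
      intro j hj W w _ h
      rwa [ncGateValues_getD_append gs [g] hj, gateVarSets_getD_append gs [g] hj]
    have hV : ∀ j, vars ((ncGateValues gs).getD j 0) ⊆ (gateVarSets gs).getD j ∅ :=
      vars_ncGateValues gs
    intro i w hw hkw
    rcases lt_trichotomy i gs.length with hi | rfl | hi
    · -- an old gate
      rw [ncGateValues_getD_append gs [g] hi] at hw
      obtain ⟨j, hji, h⟩ := ih i w hw hkw
      refine ⟨j, hji, lift (lt_of_le_of_lt hji hi) w (Or.inr trivial) ?_⟩
      rwa [gateVarSets_getD_append gs [g] hi]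
    · -- the new gate
      rw [ncGateValues_getD_length] at hw
      rw [gateVarSets_getD_length]
      cases g with
      | sum args =>
        obtain ⟨f, hf, hwf⟩ := exists_of_mem_supp_sum _ hw
        obtain ⟨⟨c, u⟩, hcu, rfl⟩ := List.mem_map.1 hf
        obtain ⟨j, hj, α, γ, β, h, hγ, h1, h3, hd, hs⟩ :=
          heavy k hk gs ihlt u (supp_smul _ _ hwf) (by omega)
        exact ⟨j, hj.le, lift hj w (Or.inr trivial) ⟨α, γ, β, h, hγ, h1, h3, hd, hs.trans
          (operandVarSet_subset_gateVarSet _ (.sum args) (List.mem_map_of_mem (f := Prod.snd) hcu))⟩⟩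
      | prod args =>
        have hlen : args.length ≤ 2 := h2 (.prod args) (List.mem_append_right _ (by simp))
        match args, hlen, hw with
        | [], _, hw =>
          simp only [ncGateEval, List.map_nil, List.prod_nil] at hw
          rw [← map_one (algebraMap R (FreeAlgebra R σ))] at hw
          have := Finset.mem_singleton.1 (supp_algebraMap (1 : R) hw)
          rw [this] at hkw
          simp at hkw
          omega
        | [u], _, hw =>
          simp only [ncGateEval, List.map_cons, List.map_nil, List.prod_cons, List.prod_nil,
            mul_one] at hw
          obtain ⟨j, hj, α, γ, β, h, hγ, h1, h3, hd, hs⟩ := heavy k hk gs ihlt u hw (by omega)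
          exact ⟨j, hj.le, lift hj w (Or.inr trivial) ⟨α, γ, β, h, hγ, h1, h3, hd,
            hs.trans (operandVarSet_subset_gateVarSet _ (.prod [u]) (by simp [Gate.args]))⟩⟩
        | [u₁, u₂], _, hw =>
          simp only [ncGateEval, List.map_cons, List.map_nil, List.prod_cons, List.prod_nil,
            mul_one] at hw
          obtain ⟨w₁, hw₁, w₂, hw₂, rfl⟩ := supp_mul _ _ hw
          have hdisj : Disjoint (operandVarSet (gateVarSets gs) u₁)
              (operandVarSet (gateVarSets gs) u₂) := by
            have := hsm gs.length [u₁, u₂] (by simp)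
            rw [List.take_left' rfl] at this
            simpa using this
          have hl₁ : letters w₁ ⊆ operandVarSet (gateVarSets gs) u₁ :=
            (letters_subset_vars hw₁).trans (vars_ncOperandEval hV u₁)
          have hl₂ : letters w₂ ⊆ operandVarSet (gateVarSets gs) u₂ :=
            (letters_subset_vars hw₂).trans (vars_ncOperandEval hV u₂)
          rw [FreeMonoid.length_mul] at hkw
          by_cases hle : w₂.length ≤ w₁.length
          · obtain ⟨j, hj, α, γ, β, h, hγ, h1, h3, hd, hs⟩ := heavy k hk gs ihlt u₁ hw₁ (by omega)
            refine ⟨j, hj.le, lift hj _ (Or.inr trivial) ⟨α, γ, β * w₂, by rw [h]; simp [mul_assoc],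
              hγ, h1, h3, ?_, hs.trans (operandVarSet_subset_gateVarSet _ (.prod [u₁, u₂]) (by simp [Gate.args]))⟩⟩
            rw [letters_mul, ← Finset.union_assoc, Finset.disjoint_union_left]
            exact ⟨hd, (hdisj.symm.mono_left hl₂).mono_right hs⟩
          · obtain ⟨j, hj, α, γ, β, h, hγ, h1, h3, hd, hs⟩ := heavy k hk gs ihlt u₂ hw₂ (by omega)
            refine ⟨j, hj.le, lift hj _ (Or.inr trivial) ⟨w₁ * α, γ, β, by rw [h]; simp [mul_assoc],
              hγ, h1, h3, ?_, hs.trans (operandVarSet_subset_gateVarSet _ (.prod [u₁, u₂]) (by simp [Gate.args]))⟩⟩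
            rw [letters_mul, Finset.union_assoc, Finset.disjoint_union_left]
            exact ⟨(hdisj.mono_left hl₁).mono_right hs, hd⟩
        | _ :: _ :: _ :: _, hlen, _ => simp at hlen
    · -- beyond the list
      rw [ncGateValues_getD_of_le _ (by rw [List.length_append, List.length_singleton]; omega),
        supp_zero] at hw
      simp at hw

end Block

end Summit.ValiantsHypothesis.ValiantsHypothesis.Theorems.ApBlock
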